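import Mathlib

/-!
# SoloBlind — weighted Schur test and Neumann fixed point (LEMMA (P-N), PLAN §120.7)

The coupled column system of the frozen streak/roll model reads, after eliminating the roll chain,
`s = s⁰ + L s` with `s⁰` the certified sub-model solution and `L = A_s⁻¹ B A_r⁻¹ (εc)`.  The certificate
("engine L") supplies positive weights `w` and a number `q < 1` with the weighted absolute row sums
`∑ j, ‖L m j‖ * w j ≤ q * w m`.  This file proves the finite-dimensional consequences used by LEMMA (P-N):

* `schur_mulVec_le` : an envelope `‖v j‖ ≤ B w j` is mapped to `‖(L v) m‖ ≤ q B w m`;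
* `fixedPoint_bound` : any solution of `s = s⁰ + L s` with `‖s⁰ j‖ ≤ B₀ w j` satisfies
  `‖s m‖ ≤ B₀/(1-q) · w m` and `‖s m - s⁰ m‖ ≤ q B₀/(1-q) · w m`;
* `fixedPoint_eq_zero`, `isUnit_one_sub`, `fixedPoint_existsUnique` : `1 - L` is invertible, so the
  fixed point exists and is unique.
-/

namespace Summit.AnomalousDissipation.SoloBlind.WeightedNeumann

open Finset Matrix

variable {n : ℕ} {L : Matrix (Fin n) (Fin n) ℂ} {w : Fin n → ℝ} {q : ℝ}

/-- Weighted Schur test: an envelope `B · w` is mapped by `L` into the envelope `q B · w`. -/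
theorem schur_mulVec_le (hw : ∀ m, 0 < w m) (hrow : ∀ m, ∑ j, ‖L m j‖ * w j ≤ q * w m)
    {v : Fin n → ℂ} {B : ℝ} (hv : ∀ j, ‖v j‖ ≤ B * w j) (m : Fin n) :
    ‖(L *ᵥ v) m‖ ≤ q * B * w m := by
  have hB : 0 ≤ B := by
    have h := (norm_nonneg (v m)).trans (hv m)
    by_contra hB
    push Not at hB
    have := mul_neg_of_neg_of_pos hB (hw m)
    linarith
  calc ‖(L *ᵥ v) m‖ = ‖∑ j, L m j * v j‖ := by rfl
    _ ≤ ∑ j, ‖L m j * v j‖ := norm_sum_le _ _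
    _ ≤ ∑ j, ‖L m j‖ * (B * w j) := by
        refine sum_le_sum fun j _ => ?_
        rw [norm_mul]; exact mul_le_mul_of_nonneg_left (hv j) (norm_nonneg _)
    _ = B * ∑ j, ‖L m j‖ * w j := by rw [mul_sum]; refine sum_congr rfl fun j _ => by ring
    _ ≤ B * (q * w m) := mul_le_mul_of_nonneg_left (hrow m) hB
    _ = q * B * w m := by ring

/-- The weighted maximum of `‖v ·‖ / w ·` is attained (for `n ≠ 0`) and bounds `v` pointwise. -/
theorem exists_weighted_max (hw : ∀ m, 0 < w m) (v : Fin n → ℂ) (hn : n ≠ 0) :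
    ∃ m₀ : Fin n, ∀ j, ‖v j‖ ≤ (‖v m₀‖ / w m₀) * w j := by
  have hne : (univ : Finset (Fin n)).Nonempty := by
    obtain ⟨k, hk⟩ := Nat.exists_eq_succ_of_ne_zero hn
    subst hk; exact univ_nonempty
  obtain ⟨m₀, -, hmax⟩ := exists_max_image univ (fun m => ‖v m‖ / w m) hne
  refine ⟨m₀, fun j => ?_⟩
  have hj := hmax j (mem_univ j)
  have := (div_le_iff₀ (hw j)).mp hj
  linarith

/-- A priori bound for solutions of the fixed-point equation `s = s⁰ + L s`. -/
theorem fixedPoint_bound (hw : ∀ m, 0 < w m) (hq : q < 1) (hrow : ∀ m, ∑ j, ‖L m j‖ * w j ≤ q * w m)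
    {s s₀ : Fin n → ℂ} (hs : s = s₀ + L *ᵥ s) {B₀ : ℝ} (h₀ : ∀ j, ‖s₀ j‖ ≤ B₀ * w j) :
    (∀ m, ‖s m‖ ≤ B₀ / (1 - q) * w m) ∧ (∀ m, ‖s m - s₀ m‖ ≤ q * B₀ / (1 - q) * w m) := by
  rcases Nat.eq_zero_or_pos n with hn | hn
  · subst hn; exact ⟨fun m => m.elim0, fun m => m.elim0⟩
  obtain ⟨m₀, hm₀⟩ := exists_weighted_max hw s (by omega)
  set B := ‖s m₀‖ / w m₀ with hB
  -- the key inequality at the maximiser: B w ≤ B₀ w + q B w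
  have hLs : ∀ m, ‖(L *ᵥ s) m‖ ≤ q * B * w m := schur_mulVec_le hw hrow hm₀
  have hkey : B * w m₀ ≤ B₀ * w m₀ + q * B * w m₀ := by
    have h1 : ‖s m₀‖ = B * w m₀ := by rw [hB, div_mul_cancel₀ _ (hw m₀).ne']
    have h2 : ‖s m₀‖ ≤ ‖s₀ m₀‖ + ‖(L *ᵥ s) m₀‖ := by
      conv_lhs => rw [hs]
      exact norm_add_le _ _
    linarith [h₀ m₀, hLs m₀]
  have hBle : B ≤ B₀ / (1 - q) := by
    rw [le_div_iff₀ (by linarith)]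
    nlinarith [hw m₀]
  have hB0 : 0 ≤ B := div_nonneg (norm_nonneg _) (hw m₀).le
  refine ⟨fun m => (hm₀ m).trans (mul_le_mul_of_nonneg_right hBle (hw m).le), fun m => ?_⟩
  have : s m - s₀ m = (L *ᵥ s) m := by
    have := congrArg (fun f => f m) hs
    simp only [Pi.add_apply] at this
    rw [this]; ring
  rw [this]
  refine (hLs m).trans ?_
  have hq0 : 0 ≤ q := by
    have := (hrow m₀)
    have hs0 : 0 ≤ ∑ j, ‖L m₀ j‖ * w j := sum_nonneg fun j _ => mul_nonneg (norm_nonneg _) (hw j).le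
    nlinarith [hw m₀]
  have : q * B ≤ q * B₀ / (1 - q) := by
    rw [mul_div_assoc]; exact mul_le_mul_of_nonneg_left hBle hq0
  exact mul_le_mul_of_nonneg_right this (hw m).le

/-- Homogeneous solutions vanish: `v = L v` forces `v = 0`. -/
theorem fixedPoint_eq_zero (hw : ∀ m, 0 < w m) (hq : q < 1) (hrow : ∀ m, ∑ j, ‖L m j‖ * w j ≤ q * w m)
    {v : Fin n → ℂ} (hv : v = L *ᵥ v) : v = 0 := by
  have h := (fixedPoint_bound hw hq hrow (s₀ := 0) (by simpa using hv) (B₀ := 0)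
    (fun j => by simp)).1
  funext m
  have := h m
  simp only [zero_div, zero_mul, norm_le_zero_iff] at this
  simpa using this

/-- `1 - L` is invertible. -/
theorem isUnit_one_sub (hw : ∀ m, 0 < w m) (hq : q < 1) (hrow : ∀ m, ∑ j, ‖L m j‖ * w j ≤ q * w m) :
    IsUnit (1 - L) := by
  rw [← mulVec_injective_iff_isUnit]
  intro u v huv
  have h : u - v = L *ᵥ (u - v) := by
    have := huv
    simp only [sub_mulVec, one_mulVec] at this
    rw [mulVec_sub]
    exact sub_eq_sub_iff_sub_eq_sub.mp this |> fun h => by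
      -- u - L u = v - L v  ⇒  u - v = L u - L v
      linear_combination this
  exact sub_eq_zero.mp (fixedPoint_eq_zero hw hq hrow h)

/-- Existence and uniqueness of the Neumann fixed point `s = s⁰ + L s`. -/
theorem fixedPoint_existsUnique (hw : ∀ m, 0 < w m) (hq : q < 1)
    (hrow : ∀ m, ∑ j, ‖L m j‖ * w j ≤ q * w m) (s₀ : Fin n → ℂ) :
    ∃! s : Fin n → ℂ, s = s₀ + L *ᵥ s := by
  have hU := isUnit_one_sub hw hq hrow
  obtain ⟨s, hs⟩ := (mulVec_surjective_iff_isUnit.mpr hU) s₀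
  refine ⟨s, ?_, fun t ht => ?_⟩
  · simp only [sub_mulVec, one_mulVec] at hs
    rw [← hs]; abel
  · have ht' : t = s₀ + L *ᵥ t := ht
    have h : t - s = L *ᵥ (t - s) := by
      rw [mulVec_sub]
      simp only [sub_mulVec, one_mulVec] at hs
      linear_combination ht' - hs
    exact sub_eq_zero.mp (fixedPoint_eq_zero hw hq hrow h)

end Summit.AnomalousDissipation.SoloBlind.WeightedNeumann
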